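import Summits.CriticalPhenomena.PercolationContinuityZ3.Theorems.PercNearOneGluingNoHeavyLowerTailSahiOneStepOneShared
import Summits.CriticalPhenomena.PercolationContinuityZ3.Theorems.PercNearOneGluingNoHeavyLowerTailSahiOneStepFreeStep
import HarnessLib

/-!
# One-step scheme: at most one shared COUNTED coordinate (free-coordinate peeling) and the `E₃` corollaries

Prover prim-ineq-prove-3 gen 26 (`--supports stmt-CriticalPhenomena-4575`; memo
`run/shared/lean/prim/prim-ineq-prove-3/FINDING-G26-ONE-SHARED-COORDINATE.md`, THEOREM 1).  No definitions, no sorries.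

* (from `…FreeStep`) `osN_threshold_nonneg_of_sections` — free-coordinate step: for `e ∉ F`, `0 ≤ n` for the four section pairs at `e`
  gives `0 ≤ n(1_A,1_B)` (free splitting identity `osN_ind_ind_free_split`, remaining term nonnegative).
* `osN_sharedOne_nonneg` — `(2′)` for the first slot `{N_F ≥ t}` and all increasing `A`, `B` with `S_A ∩ S_B ⊆ {e}`, `e` arbitrary
  (`e ∈ F`: `osN_oneShared_nonneg`; `e ∉ F`: one free step onto disjointly supported pairs, `osN_disjoint_nonneg`).
* **`osN_sharedCountedLeOne_nonneg`** — `(2′)` whenever `S_A ∩ S_B ∩ F ⊆ {e}`: the supports may share ANY number of coordinates outside the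
  block `F` (induction on their number, one free step each).  Cardinality forms `osN_interCardLeOne_nonneg` (`#(S_A ∩ S_B) ≤ 1`) and
  `osN_sharedCountedCardLeOne_nonneg` (`#(S_A ∩ S_B ∩ F) ≤ 1`).
* `sahiE3_threshold_{sharedOne,interCardLeOne,sharedCountedLeOne,sharedCountedCardLeOne}_nonneg` — Kahn C5 / Sahi `C₃`
  `0 ≤ E₃(1_{N_F ≥ t}, 1_A, 1_B)` for all such pairs, every product measure (with `m′ ≥ 0`, `osMp_threshold_nonneg_all`).
-/

noncomputable section

namespace Summit.CriticalPhenomena.PercolationContinuityZ3.Theorems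

namespace SahiOneStep

section Free

variable {ι : Type*} [Fintype ι] [DecidableEq ι]

open MeasureTheory Finset
open Literature.Probability.Percolation (DeterminedBy determinedBy_iff determinedBy_univ)
open Literature.Probability.LatticeModels (prodBernoulli sahiE3)
open Literature.Probability.Percolation.DecisionTree (ind)
open SahiE3Sections (determinedBy_section_insert determinedBy_section_sdiff)
open scoped Classical

/-- **`(2′)` for increasing events sharing at most one coordinate (anywhere).**  If `SA ∩ SB ⊆ {e}` with `e` arbitrary (in the block
or not), then `0 ≤ n(1_A, 1_B)` for the first slot `{N_F ≥ t}`: for `e ∉ F` the coordinate is free for the first slot and the free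
splitting identity (`osN_threshold_nonneg_of_sections`) reduces to four disjointly supported pairs (`osN_disjoint_nonneg`). [this work] -/
theorem osN_sharedOne_nonneg (p : ι → unitInterval) (F : Finset ι) (t : ℕ) {A B : Set (Set ι)}
    (hA : IsUpperSet A) (hB : IsUpperSet B) {SA SB : Finset ι} (hAS : DeterminedBy A (↑SA : Set ι))
    (hBS : DeterminedBy B (↑SB : Set ι)) {e : ι} (hI : SA ∩ SB ⊆ {e}) :
    0 ≤ osN p {ω : Set ι | t ≤ (F.filter (· ∈ ω)).card} (ind A) (ind B) := by
  by_cases he : e ∈ F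
  · exact osN_oneShared_nonneg p F t hA hB hAS hBS he hI
  -- `e ∉ F`: free coordinate; the sections at `e` are disjointly supported
  have hcoeA : (↑(SA.erase e) : Set ι) = (↑SA : Set ι) \ {e} := by rw [Finset.coe_erase]
  have hcoeB : (↑(SB.erase e) : Set ι) = (↑SB : Set ι) \ {e} := by rw [Finset.coe_erase]
  have hd : Disjoint (SA.erase e) (SB.erase e) := by
    rw [Finset.disjoint_left]
    intro i hiA hiB
    have hi : i ∈ SA ∩ SB := Finset.mem_inter.2 ⟨(Finset.mem_erase.1 hiA).2, (Finset.mem_erase.1 hiB).2⟩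
    exact (Finset.mem_erase.1 hiA).1 (Finset.mem_singleton.1 (hI hi))
  have hA1 : DeterminedBy {ω : Set ι | insert e ω ∈ A} (↑(SA.erase e) : Set ι) := by
    rw [hcoeA]; exact determinedBy_section_insert hAS e
  have hA0 : DeterminedBy {ω : Set ι | ω \ {e} ∈ A} (↑(SA.erase e) : Set ι) := by
    rw [hcoeA]; exact determinedBy_section_sdiff hAS e
  have hB1 : DeterminedBy {ω : Set ι | insert e ω ∈ B} (↑(SB.erase e) : Set ι) := by
    rw [hcoeB]; exact determinedBy_section_insert hBS e
  have hB0 : DeterminedBy {ω : Set ι | ω \ {e} ∈ B} (↑(SB.erase e) : Set ι) := by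
    rw [hcoeB]; exact determinedBy_section_sdiff hBS e
  exact osN_threshold_nonneg_of_sections p F t hA hB he
    (osN_disjoint_nonneg p F t (isUpperSet_section_insert hA e) (isUpperSet_section_insert hB e) hA1 hB1 hd)
    (osN_disjoint_nonneg p F t (isUpperSet_section_sdiff hA e) (isUpperSet_section_sdiff hB e) hA0 hB0 hd)
    (osN_disjoint_nonneg p F t (isUpperSet_section_insert hA e) (isUpperSet_section_sdiff hB e) hA1 hB0 hd)
    (osN_disjoint_nonneg p F t (isUpperSet_section_sdiff hA e) (isUpperSet_section_insert hB e) hA0 hB1 hd)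

/-- **Kahn C5 / Sahi `C₃`, one shared coordinate anywhere.**  `0 ≤ E₃(1_{N_F ≥ t}, 1_A, 1_B)` whenever the increasing events
`A`, `B` are determined by finite coordinate sets with `SA ∩ SB ⊆ {e}`. [this work] -/
theorem sahiE3_threshold_sharedOne_nonneg (p : ι → unitInterval) (F : Finset ι) (t : ℕ) {A B : Set (Set ι)}
    (hA : IsUpperSet A) (hB : IsUpperSet B) {SA SB : Finset ι} (hAS : DeterminedBy A (↑SA : Set ι))
    (hBS : DeterminedBy B (↑SB : Set ι)) {e : ι} (hI : SA ∩ SB ⊆ {e}) :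
    0 ≤ sahiE3 (prodBernoulli p) {ω : Set ι | t ≤ (F.filter (· ∈ ω)).card} A B := by
  rw [← osT_ind_ind, osT_eq_osMp_add_osN]
  exact add_nonneg (osMp_threshold_nonneg_all p F t hA hB) (osN_sharedOne_nonneg p F t hA hB hAS hBS hI)

/-- **`(2′)`, cardinality form.**  If the supports of the increasing events `A`, `B` intersect in at most one coordinate
(`#(S_A ∩ S_B) ≤ 1`), then `0 ≤ n(1_A, 1_B)` for every Hamming-threshold first slot and every product measure. [this work] -/
theorem osN_interCardLeOne_nonneg (p : ι → unitInterval) (F : Finset ι) (t : ℕ) {A B : Set (Set ι)}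
    (hA : IsUpperSet A) (hB : IsUpperSet B) {SA SB : Finset ι} (hAS : DeterminedBy A (↑SA : Set ι))
    (hBS : DeterminedBy B (↑SB : Set ι)) (hI : (SA ∩ SB).card ≤ 1) :
    0 ≤ osN p {ω : Set ι | t ≤ (F.filter (· ∈ ω)).card} (ind A) (ind B) := by
  rcases Nat.lt_or_ge (SA ∩ SB).card 1 with h0 | h1
  · have hd : Disjoint SA SB := Finset.disjoint_iff_inter_eq_empty.2 (Finset.card_eq_zero.1 (by omega))
    exact osN_disjoint_nonneg p F t hA hB hAS hBS hd
  · obtain ⟨e, he⟩ := Finset.card_eq_one.1 (le_antisymm hI h1)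
    exact osN_sharedOne_nonneg p F t hA hB hAS hBS (e := e) (by rw [he])

/-- **Kahn C5 / Sahi `C₃`, cardinality form**: `0 ≤ E₃(1_{N_F ≥ t}, 1_A, 1_B)` for all increasing `A`, `B` whose supports meet in at
most one coordinate, every product measure, every block `F`, every `t`. [this work] -/
theorem sahiE3_threshold_interCardLeOne_nonneg (p : ι → unitInterval) (F : Finset ι) (t : ℕ) {A B : Set (Set ι)}
    (hA : IsUpperSet A) (hB : IsUpperSet B) {SA SB : Finset ι} (hAS : DeterminedBy A (↑SA : Set ι))
    (hBS : DeterminedBy B (↑SB : Set ι)) (hI : (SA ∩ SB).card ≤ 1) :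
    0 ≤ sahiE3 (prodBernoulli p) {ω : Set ι | t ≤ (F.filter (· ∈ ω)).card} A B := by
  rw [← osT_ind_ind, osT_eq_osMp_add_osN]
  exact add_nonneg (osMp_threshold_nonneg_all p F t hA hB) (osN_interCardLeOne_nonneg p F t hA hB hAS hBS hI)

/-- **`(2′)` for increasing events sharing at most one COUNTED coordinate.**  If `SA ∩ SB ∩ F ⊆ {e}` — the supports may share any
number of coordinates OUTSIDE the block `F` — then `0 ≤ n(1_A, 1_B)` for the first slot `{N_F ≥ t}` and every product measure:
induction on the number of shared uncounted coordinates, peeled one at a time by `osN_threshold_nonneg_of_sections` (the sections at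
such a coordinate are again increasing, determined by the erased supports); base case `osN_sharedOne_nonneg`. [this work] -/
theorem osN_sharedCountedLeOne_nonneg (p : ι → unitInterval) (F : Finset ι) (t : ℕ) {A B : Set (Set ι)}
    (hA : IsUpperSet A) (hB : IsUpperSet B) {SA SB : Finset ι} (hAS : DeterminedBy A (↑SA : Set ι))
    (hBS : DeterminedBy B (↑SB : Set ι)) {e : ι} (hI : SA ∩ SB ∩ F ⊆ {e}) :
    0 ≤ osN p {ω : Set ι | t ≤ (F.filter (· ∈ ω)).card} (ind A) (ind B) := by
  suffices h : ∀ (n : ℕ) {A B : Set (Set ι)}, IsUpperSet A → IsUpperSet B → ∀ {SA SB : Finset ι},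
      DeterminedBy A (↑SA : Set ι) → DeterminedBy B (↑SB : Set ι) → SA ∩ SB ∩ F ⊆ {e} → ((SA ∩ SB) \ F).card ≤ n →
      0 ≤ osN p {ω : Set ι | t ≤ (F.filter (· ∈ ω)).card} (ind A) (ind B) from
    h _ hA hB hAS hBS hI le_rfl
  intro n
  induction n with
  | zero =>
    intro A B hA hB SA SB hAS hBS hI hn
    have h0 : (SA ∩ SB) \ F = ∅ := Finset.card_eq_zero.1 (Nat.le_zero.1 hn)
    have hsub : SA ∩ SB ⊆ {e} := by
      intro i hi
      have hiF : i ∈ F := by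
        by_contra hiF
        have hi' : i ∈ (SA ∩ SB) \ F := Finset.mem_sdiff.2 ⟨hi, hiF⟩
        rw [h0] at hi'
        simp at hi'
      exact hI (Finset.mem_inter.2 ⟨hi, hiF⟩)
    exact osN_sharedOne_nonneg p F t hA hB hAS hBS hsub
  | succ n ih =>
    intro A B hA hB SA SB hAS hBS hI hn
    by_cases hle : ((SA ∩ SB) \ F).card ≤ n
    · exact ih hA hB hAS hBS hI hle
    obtain ⟨e', he'⟩ := Finset.card_pos.1 (by omega : 0 < ((SA ∩ SB) \ F).card)
    have he'F : e' ∉ F := (Finset.mem_sdiff.1 he').2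
    have hcoeA : (↑(SA.erase e') : Set ι) = (↑SA : Set ι) \ {e'} := by rw [Finset.coe_erase]
    have hcoeB : (↑(SB.erase e') : Set ι) = (↑SB : Set ι) \ {e'} := by rw [Finset.coe_erase]
    have hA1 : DeterminedBy {ω : Set ι | insert e' ω ∈ A} (↑(SA.erase e') : Set ι) := by
      rw [hcoeA]; exact determinedBy_section_insert hAS e'
    have hA0 : DeterminedBy {ω : Set ι | ω \ {e'} ∈ A} (↑(SA.erase e') : Set ι) := by
      rw [hcoeA]; exact determinedBy_section_sdiff hAS e'
    have hB1 : DeterminedBy {ω : Set ι | insert e' ω ∈ B} (↑(SB.erase e') : Set ι) := by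
      rw [hcoeB]; exact determinedBy_section_insert hBS e'
    have hB0 : DeterminedBy {ω : Set ι | ω \ {e'} ∈ B} (↑(SB.erase e') : Set ι) := by
      rw [hcoeB]; exact determinedBy_section_sdiff hBS e'
    have hI' : SA.erase e' ∩ SB.erase e' ∩ F ⊆ {e} := by
      intro i hi
      simp only [Finset.mem_inter, Finset.mem_erase] at hi
      exact hI (Finset.mem_inter.2 ⟨Finset.mem_inter.2 ⟨hi.1.1.2, hi.1.2.2⟩, hi.2⟩)
    have hn' : ((SA.erase e' ∩ SB.erase e') \ F).card ≤ n := by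
      have hEq : (SA.erase e' ∩ SB.erase e') \ F = ((SA ∩ SB) \ F).erase e' := by
        ext i
        simp only [Finset.mem_sdiff, Finset.mem_inter, Finset.mem_erase]
        tauto
      rw [hEq, Finset.card_erase_of_mem he']
      omega
    exact osN_threshold_nonneg_of_sections p F t hA hB he'F
      (ih (isUpperSet_section_insert hA e') (isUpperSet_section_insert hB e') hA1 hB1 hI' hn')
      (ih (isUpperSet_section_sdiff hA e') (isUpperSet_section_sdiff hB e') hA0 hB0 hI' hn')
      (ih (isUpperSet_section_insert hA e') (isUpperSet_section_sdiff hB e') hA1 hB0 hI' hn')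
      (ih (isUpperSet_section_sdiff hA e') (isUpperSet_section_insert hB e') hA0 hB1 hI' hn')

/-- **Kahn C5 / Sahi `C₃` for increasing events sharing at most one counted coordinate**: `0 ≤ E₃(1_{N_F ≥ t}, 1_A, 1_B)` whenever
`SA ∩ SB ∩ F ⊆ {e}`, every product measure. [this work] -/
theorem sahiE3_threshold_sharedCountedLeOne_nonneg (p : ι → unitInterval) (F : Finset ι) (t : ℕ) {A B : Set (Set ι)}
    (hA : IsUpperSet A) (hB : IsUpperSet B) {SA SB : Finset ι} (hAS : DeterminedBy A (↑SA : Set ι))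
    (hBS : DeterminedBy B (↑SB : Set ι)) {e : ι} (hI : SA ∩ SB ∩ F ⊆ {e}) :
    0 ≤ sahiE3 (prodBernoulli p) {ω : Set ι | t ≤ (F.filter (· ∈ ω)).card} A B := by
  rw [← osT_ind_ind, osT_eq_osMp_add_osN]
  exact add_nonneg (osMp_threshold_nonneg_all p F t hA hB) (osN_sharedCountedLeOne_nonneg p F t hA hB hAS hBS hI)

/-- **`(2′)`, counted-cardinality form**: if `#(SA ∩ SB ∩ F) ≤ 1` then `0 ≤ n(1_A, 1_B)` for the slot `{N_F ≥ t}`, every product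
measure. [this work] -/
theorem osN_sharedCountedCardLeOne_nonneg (p : ι → unitInterval) (F : Finset ι) (t : ℕ) {A B : Set (Set ι)}
    (hA : IsUpperSet A) (hB : IsUpperSet B) {SA SB : Finset ι} (hAS : DeterminedBy A (↑SA : Set ι))
    (hBS : DeterminedBy B (↑SB : Set ι)) (hI : (SA ∩ SB ∩ F).card ≤ 1) :
    0 ≤ osN p {ω : Set ι | t ≤ (F.filter (· ∈ ω)).card} (ind A) (ind B) := by
  rcases Nat.lt_or_ge (SA ∩ SB ∩ F).card 1 with h0 | h1
  · have hE : SA ∩ SB ∩ F = ∅ := Finset.card_eq_zero.1 (by omega)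
    by_cases hd : Disjoint SA SB
    · exact osN_disjoint_nonneg p F t hA hB hAS hBS hd
    · obtain ⟨e, -⟩ : (SA ∩ SB).Nonempty := by
        rw [Finset.nonempty_iff_ne_empty]
        exact fun h => hd (Finset.disjoint_iff_inter_eq_empty.2 h)
      exact osN_sharedCountedLeOne_nonneg p F t hA hB hAS hBS (e := e) (by rw [hE]; exact Finset.empty_subset _)
  · obtain ⟨e, he⟩ := Finset.card_eq_one.1 (le_antisymm hI h1)
    exact osN_sharedCountedLeOne_nonneg p F t hA hB hAS hBS (e := e) (by rw [he])

/-- **Kahn C5 / Sahi `C₃`, counted-cardinality form**: `0 ≤ E₃(1_{N_F ≥ t}, 1_A, 1_B)` for all increasing `A`, `B` whose supports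
share at most one coordinate of the block `F` (`#(SA ∩ SB ∩ F) ≤ 1`), every product measure, every `F`, every `t`. [this work] -/
theorem sahiE3_threshold_sharedCountedCardLeOne_nonneg (p : ι → unitInterval) (F : Finset ι) (t : ℕ) {A B : Set (Set ι)}
    (hA : IsUpperSet A) (hB : IsUpperSet B) {SA SB : Finset ι} (hAS : DeterminedBy A (↑SA : Set ι))
    (hBS : DeterminedBy B (↑SB : Set ι)) (hI : (SA ∩ SB ∩ F).card ≤ 1) :
    0 ≤ sahiE3 (prodBernoulli p) {ω : Set ι | t ≤ (F.filter (· ∈ ω)).card} A B := by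
  rw [← osT_ind_ind, osT_eq_osMp_add_osN]
  exact add_nonneg (osMp_threshold_nonneg_all p F t hA hB) (osN_sharedCountedCardLeOne_nonneg p F t hA hB hAS hBS hI)

end Free

end SahiOneStep

end Summit.CriticalPhenomena.PercolationContinuityZ3.Theorems
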